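import Summits.ResolutionOfSingularities.ResolutionOfSingularities.Theorems.WildQuotientsSummitReductionStubPairOrbitNormalFormBlowupChartsOverCentreChartT
import HarnessLib

/-!
# `WildQuotients.SummitReduction` (stmt-ResolutionOfSingularities-16324), line `FramePerfect`, stub O3
# (`stub_pair_orbitNormalFormBlowup_chartsOverCentre`): the chart "`t₁ ≠ 0`" at the regular
# closed points of the double locus over the closed point

Route `ResolutionOfSingularities/WildQuotients`, crux `SummitReduction`; helper file of stub O3
(continuation of `…ChartsOverCentreChartT.lean`). On the chart `R[𝔓/c₂]` with strict transform
`f = (c₀/c₂)(c₁/c₂) - (c₃/c₂) ∏_{k ∈ S} w_k`, at a closed point `𝔔 ∋ c₀/c₂, c₁/c₂` over the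
closed point with at most ONE of the factors `c₃/c₂, w_k (k ∈ S)` in `𝔔` (de Jong 1996, p. 76:
"`u'v' - t₂'t₃ ⋯ t_s = 0`" with the right-hand side a unit times one parameter — a regular point
of the new double locus), this file PROVES the marked family `chartsOverCentre_chartT_tt`: `f`
replaces the vanishing factor in the chart family, and the boundary
`c₂c₃ ∏_{k ∈ T} w_k ≡ c₂² (c₀/c₂)(c₁/c₂) ∏_{k ∈ T ∖ S} w_k` modulo `f`. (The closed points with
two vanishing factors are the nodes of the blown-up model, treated separately.)

## Sources

* A. J. de Jong, *Smoothness, semi-stability and alterations*, Publ. Math. IHÉS 83 (1996), 4.27,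
  p. 76. [DeJong1996]
* A. J. de Jong, *Families of curves and alterations*, Ann. Inst. Fourier 47 (1997), proof of
  Prop. 5.11, p. 619. [DeJong1997]
-/

set_option linter.dupNamespace false -- the tree's summit namespace repeats `ResolutionOfSingularities`

noncomputable section

open IsLocalRing
open Literature.AlgebraicGeometry.Resolution

namespace Summit.ResolutionOfSingularities.ResolutionOfSingularities.Theorems

/-- **Chart "`t₁ ≠ 0`", the points with `u/t₁, v/t₁ ∈ 𝔔` and at most one vanishing factor in
`(t₂/t₁) ∏_{k ∈ S} w_k`** (de Jong 1996, p. 76: "`u'v' - t₂'t₃ ⋯ t_s = 0`" with the right-hand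
side a unit times a single parameter — a regular point): either `c₃/c₂ ∈ 𝔔` and `S = ∅`, and `f`
replaces `c₃/c₂` in `(c₂, c₀/c₂, c₁/c₂, c₃/c₂, w)`; or `c₃/c₂ ∉ 𝔔` and `S = {k₀}`, and `f`
replaces `w_{k₀}` in `(c₂, c₀/c₂, c₁/c₂, w)`. In both cases the boundary
`c₂c₃ ∏_{k ∈ T} w_k ≡ c₂² (c₀/c₂)(c₁/c₂) ∏_{k ∈ T ∖ S} w_k` modulo `f`.
[cite: DeJong1996, 4.27, p. 76] -/
theorem chartsOverCentre_chartT_tt {R : Type} [CommRing R] [IsRegularLocalRing R]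
    (c : Fin 4 → R) {l : ℕ} (w : Fin l → R)
    (hz : Ideal.span (Set.range (Fin.append c w)) = maximalIdeal R)
    (hd : (maximalIdeal R).spanFinrank = 4 + l)
    (𝔓 : Ideal R) (h𝔓 : 𝔓 = Ideal.span (Set.range c)) (hc : ∀ k, c k ∈ 𝔓)
    (S T : Finset (Fin l))
    (𝔔 : Ideal (blowupAlgebra 𝔓 (c 2))) [𝔔.IsMaximal]
    (h𝔔 : 𝔔.comap (algebraMap R _) = maximalIdeal R)
    (L : Type) [CommRing L] [IsLocalRing L] [Algebra (blowupAlgebra 𝔓 (c 2)) L]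
    [IsLocalization.AtPrime L 𝔔]
    (hf : blowupAlgebra.gen 𝔓 (c 2) (c 0) (hc 0) * blowupAlgebra.gen 𝔓 (c 2) (c 1) (hc 1) - blowupAlgebra.gen 𝔓 (c 2) (c 2) (hc 2) * blowupAlgebra.gen 𝔓 (c 2) (c 3) (hc 3) * algebraMap R (blowupAlgebra 𝔓 (c 2)) (∏ k ∈ S, w k) ∈ 𝔔)
    (hST : S ⊆ T) (h0 : blowupAlgebra.gen 𝔓 (c 2) (c 0) (hc 0) ∈ 𝔔) (h1 : blowupAlgebra.gen 𝔓 (c 2) (c 1) (hc 1) ∈ 𝔔)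
    (hν : (blowupAlgebra.gen 𝔓 (c 2) (c 3) (hc 3) ∈ 𝔔 → S = ∅) ∧ S.card ≤ 1) :
    ∃ (N : ℕ) (Z : Fin N → L) (i_f i₀ : Fin N) (ex : Fin N → ℕ) (U : L),
      i_f ≠ i₀ ∧ IsRsopPart Z ∧ Z i_f = algebraMap (blowupAlgebra 𝔓 (c 2)) L (blowupAlgebra.gen 𝔓 (c 2) (c 0) (hc 0) * blowupAlgebra.gen 𝔓 (c 2) (c 1) (hc 1) - blowupAlgebra.gen 𝔓 (c 2) (c 2) (hc 2) * blowupAlgebra.gen 𝔓 (c 2) (c 3) (hc 3) * algebraMap R (blowupAlgebra 𝔓 (c 2)) (∏ k ∈ S, w k)) ∧ Z i₀ = algebraMap (blowupAlgebra 𝔓 (c 2)) L (algebraMap R (blowupAlgebra 𝔓 (c 2)) (c 2)) ∧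
      ex i₀ = 2 ∧ ex i_f = 0 ∧ (∀ i, i ≠ i₀ → ex i ≤ 1) ∧ IsUnit U ∧
      algebraMap (blowupAlgebra 𝔓 (c 2)) L (algebraMap R (blowupAlgebra 𝔓 (c 2)) (c 2 * c 3 * ∏ k ∈ T, w k)) - U * ∏ i, Z i ^ ex i ∈ Ideal.span {algebraMap (blowupAlgebra 𝔓 (c 2)) L (blowupAlgebra.gen 𝔓 (c 2) (c 0) (hc 0) * blowupAlgebra.gen 𝔓 (c 2) (c 1) (hc 1) - blowupAlgebra.gen 𝔓 (c 2) (c 2) (hc 2) * blowupAlgebra.gen 𝔓 (c 2) (c 3) (hc 3) * algebraMap R (blowupAlgebra 𝔓 (c 2)) (∏ k ∈ S, w k))} := by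
  classical
  have he2 : blowupAlgebra.gen 𝔓 (c 2) (c 2) (hc 2) = 1 := blowupAlgebra.gen_self 𝔓 (c 2) (hc 2)
  have hcm : ∀ m, algebraMap R (blowupAlgebra 𝔓 (c 2)) (c m) = blowupAlgebra.gen 𝔓 (c 2) (c m) (hc m) * algebraMap R (blowupAlgebra 𝔓 (c 2)) (c 2) := fun m =>
    (blowupAlgebra.gen_mul_algebraMap 𝔓 (c 2) (c m) (hc m)).symm
  have hunit : ∀ m, blowupAlgebra.gen 𝔓 (c 2) (c m) (hc m) ∉ 𝔔 →
      IsUnit (algebraMap (blowupAlgebra 𝔓 (c 2)) L (blowupAlgebra.gen 𝔓 (c 2) (c m) (hc m))) := fun m hm =>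
    IsLocalization.map_units L (⟨blowupAlgebra.gen 𝔓 (c 2) (c m) (hc m), hm⟩ : 𝔔.primeCompl)
  have hfeq : blowupAlgebra.gen 𝔓 (c 2) (c 0) (hc 0) * blowupAlgebra.gen 𝔓 (c 2) (c 1) (hc 1) - blowupAlgebra.gen 𝔓 (c 2) (c 2) (hc 2) * blowupAlgebra.gen 𝔓 (c 2) (c 3) (hc 3) * algebraMap R (blowupAlgebra 𝔓 (c 2)) (∏ k ∈ S, w k) = blowupAlgebra.gen 𝔓 (c 2) (c 0) (hc 0) * blowupAlgebra.gen 𝔓 (c 2) (c 1) (hc 1) - blowupAlgebra.gen 𝔓 (c 2) (c 3) (hc 3) * algebraMap R (blowupAlgebra 𝔓 (c 2)) (∏ k ∈ S, w k) := by rw [he2, one_mul]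
  have hbdry : algebraMap (blowupAlgebra 𝔓 (c 2)) L (algebraMap R (blowupAlgebra 𝔓 (c 2)) (c 2 * c 3 * ∏ k ∈ T, w k)) =
      algebraMap (blowupAlgebra 𝔓 (c 2)) L (algebraMap R (blowupAlgebra 𝔓 (c 2)) (c 2)) ^ 2 * algebraMap (blowupAlgebra 𝔓 (c 2)) L (blowupAlgebra.gen 𝔓 (c 2) (c 3) (hc 3)) * ∏ k ∈ T, algebraMap (blowupAlgebra 𝔓 (c 2)) L (algebraMap R (blowupAlgebra 𝔓 (c 2)) (w k)) := by
    simp only [map_mul, map_prod]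
    rw [hcm 3, map_mul]
    ring
  by_cases h3 : blowupAlgebra.gen 𝔓 (c 2) (c 3) (hc 3) ∈ 𝔔
  · -- `c₃/c₂ ∈ 𝔔` and `S = ∅`: replace `c₃/c₂`
    have hS : S = ∅ := hν.1 h3
    have hH1 : algebraMap R (blowupAlgebra 𝔓 (c 2)) (∏ k ∈ S, w k) = 1 := by rw [hS, Finset.prod_empty, map_one]
    let jJ : Fin 3 → {k : Fin 4 // k ≠ 2} := ![⟨0, by decide⟩, ⟨1, by decide⟩, ⟨3, by decide⟩]
    have hjJinj : Function.Injective jJ := by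
      intro s s' h
      fin_cases s <;> fin_cases s' <;> first | rfl | exact absurd h (by decide)
    have hjJ𝔔 : ∀ t, blowupAlgebra.gen 𝔓 (c 2) (c (jJ t).1) (hc _) ∈ 𝔔 := by
      intro t
      fin_cases t
      · exact h0
      · exact h1
      · exact h3
    have hrs := chartsOverCentre_isRsopPart_chartFamily c 2 w hz hd 𝔓 h𝔓 hc 𝔔 h𝔔 L jJ hjJinj hjJ𝔔
    set z := chartFamily c 2 w L (algebraMap R (blowupAlgebra 𝔓 (c 2))) (fun k => blowupAlgebra.gen 𝔓 (c 2) (c k) (hc k)) jJ with hzdef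
    have hz0 : z 0 = algebraMap (blowupAlgebra 𝔓 (c 2)) L (algebraMap R (blowupAlgebra 𝔓 (c 2)) (c 2)) := chartsOverCentre_chartFamily_zero c 2 w (algebraMap R (blowupAlgebra 𝔓 (c 2))) _ jJ
    have hze0 : z (Fin.castAdd l 0).succ = algebraMap (blowupAlgebra 𝔓 (c 2)) L (blowupAlgebra.gen 𝔓 (c 2) (c 0) (hc 0)) := chartsOverCentre_chartFamily_gen c 2 w (algebraMap R (blowupAlgebra 𝔓 (c 2))) _ jJ 0
    have hze1 : z (Fin.castAdd l 1).succ = algebraMap (blowupAlgebra 𝔓 (c 2)) L (blowupAlgebra.gen 𝔓 (c 2) (c 1) (hc 1)) := chartsOverCentre_chartFamily_gen c 2 w (algebraMap R (blowupAlgebra 𝔓 (c 2))) _ jJ 1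
    have hze3 : z (Fin.castAdd l 2).succ = algebraMap (blowupAlgebra 𝔓 (c 2)) L (blowupAlgebra.gen 𝔓 (c 2) (c 3) (hc 3)) := chartsOverCentre_chartFamily_gen c 2 w (algebraMap R (blowupAlgebra 𝔓 (c 2))) _ jJ 2
    have hne0 : (Fin.castAdd l (0 : Fin 3)).succ ≠ (Fin.castAdd l (2 : Fin 3)).succ := fun h =>
      absurd (Fin.castAdd_injective _ _ (Fin.succ_injective _ h)) (by decide)
    have hne1 : (Fin.castAdd l (1 : Fin 3)).succ ≠ (Fin.castAdd l (2 : Fin 3)).succ := fun h =>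
      absurd (Fin.castAdd_injective _ _ (Fin.succ_injective _ h)) (by decide)
    have hy : algebraMap (blowupAlgebra 𝔓 (c 2)) L (blowupAlgebra.gen 𝔓 (c 2) (c 0) (hc 0) * blowupAlgebra.gen 𝔓 (c 2) (c 1) (hc 1) - blowupAlgebra.gen 𝔓 (c 2) (c 2) (hc 2) * blowupAlgebra.gen 𝔓 (c 2) (c 3) (hc 3) * algebraMap R (blowupAlgebra 𝔓 (c 2)) (∏ k ∈ S, w k)) ∈ Ideal.span (Set.range z) := by
      rw [hfeq, hH1, mul_one, map_sub, map_mul, ← hze0, ← hze3]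
      exact Ideal.sub_mem _ (Ideal.mul_mem_right _ _ (Ideal.subset_span ⟨_, rfl⟩))
        (Ideal.subset_span ⟨_, rfl⟩)
    have hzmem : z (Fin.castAdd l 2).succ ∈
        Ideal.span (Set.range (Function.update z (Fin.castAdd l 2).succ (algebraMap (blowupAlgebra 𝔓 (c 2)) L (blowupAlgebra.gen 𝔓 (c 2) (c 0) (hc 0) * blowupAlgebra.gen 𝔓 (c 2) (c 1) (hc 1) - blowupAlgebra.gen 𝔓 (c 2) (c 2) (hc 2) * blowupAlgebra.gen 𝔓 (c 2) (c 3) (hc 3) * algebraMap R (blowupAlgebra 𝔓 (c 2)) (∏ k ∈ S, w k))))) := by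
      have key : z (Fin.castAdd l 2).succ =
          Function.update z (Fin.castAdd l 2).succ (algebraMap (blowupAlgebra 𝔓 (c 2)) L (blowupAlgebra.gen 𝔓 (c 2) (c 0) (hc 0) * blowupAlgebra.gen 𝔓 (c 2) (c 1) (hc 1) - blowupAlgebra.gen 𝔓 (c 2) (c 2) (hc 2) * blowupAlgebra.gen 𝔓 (c 2) (c 3) (hc 3) * algebraMap R (blowupAlgebra 𝔓 (c 2)) (∏ k ∈ S, w k))) (Fin.castAdd l 0).succ *
            Function.update z (Fin.castAdd l 2).succ (algebraMap (blowupAlgebra 𝔓 (c 2)) L (blowupAlgebra.gen 𝔓 (c 2) (c 0) (hc 0) * blowupAlgebra.gen 𝔓 (c 2) (c 1) (hc 1) - blowupAlgebra.gen 𝔓 (c 2) (c 2) (hc 2) * blowupAlgebra.gen 𝔓 (c 2) (c 3) (hc 3) * algebraMap R (blowupAlgebra 𝔓 (c 2)) (∏ k ∈ S, w k))) (Fin.castAdd l 1).succ -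
          Function.update z (Fin.castAdd l 2).succ (algebraMap (blowupAlgebra 𝔓 (c 2)) L (blowupAlgebra.gen 𝔓 (c 2) (c 0) (hc 0) * blowupAlgebra.gen 𝔓 (c 2) (c 1) (hc 1) - blowupAlgebra.gen 𝔓 (c 2) (c 2) (hc 2) * blowupAlgebra.gen 𝔓 (c 2) (c 3) (hc 3) * algebraMap R (blowupAlgebra 𝔓 (c 2)) (∏ k ∈ S, w k))) (Fin.castAdd l 2).succ := by
        rw [Function.update_self, Function.update_of_ne hne0, Function.update_of_ne hne1, hze0, hze1, hze3,
          hfeq, hH1, mul_one, map_sub, map_mul]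
        ring
      rw [key]
      exact Ideal.sub_mem _ (Ideal.mul_mem_left _ _ (Ideal.subset_span ⟨_, rfl⟩)) (Ideal.subset_span ⟨_, rfl⟩)
    have hspan := chartsOverCentre_span_range_update_eq z _ _ hy hzmem
    refine ⟨3 + l + 1, Function.update z (Fin.castAdd l 2).succ (algebraMap (blowupAlgebra 𝔓 (c 2)) L (blowupAlgebra.gen 𝔓 (c 2) (c 0) (hc 0) * blowupAlgebra.gen 𝔓 (c 2) (c 1) (hc 1) - blowupAlgebra.gen 𝔓 (c 2) (c 2) (hc 2) * blowupAlgebra.gen 𝔓 (c 2) (c 3) (hc 3) * algebraMap R (blowupAlgebra 𝔓 (c 2)) (∏ k ∈ S, w k))), (Fin.castAdd l 2).succ, 0,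
      Fin.cons 2 (Fin.append ![1, 1, 0] fun k => if k ∈ T then 1 else 0), 1, Fin.succ_ne_zero _,
      chartsOverCentre_isRsopPart_of_span_eq hrs hspan, Function.update_self _ _ _, ?_, rfl, ?_,
      fun i hi => ?_, isUnit_one, ?_⟩
    · rw [Function.update_of_ne (Fin.succ_ne_zero _).symm, hz0]
    · rw [Fin.cons_succ, Fin.append_left]
      rfl
    · obtain ⟨i, rfl⟩ := Fin.exists_succ_eq.mpr hi
      rw [Fin.cons_succ]
      refine Fin.addCases (fun t => ?_) (fun k => ?_) i
      · rw [Fin.append_left]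
        fin_cases t <;> simp
      · rw [Fin.append_right]
        split_ifs <;> omega
    · rw [chartsOverCentre_prod_update_pow _ _ _ _ (by rw [Fin.cons_succ, Fin.append_left]; rfl), hzdef,
        chartsOverCentre_prod_chartFamily_pow, hbdry, Fin.prod_univ_three]
      simp only [jJ, Matrix.cons_val_zero, Matrix.cons_val_one, Matrix.cons_val, pow_zero, pow_one,
        one_mul, mul_one]
      rw [show algebraMap (blowupAlgebra 𝔓 (c 2)) L (algebraMap R (blowupAlgebra 𝔓 (c 2)) (c 2)) ^ 2 * algebraMap (blowupAlgebra 𝔓 (c 2)) L (blowupAlgebra.gen 𝔓 (c 2) (c 3) (hc 3)) * ∏ k ∈ T, algebraMap (blowupAlgebra 𝔓 (c 2)) L (algebraMap R (blowupAlgebra 𝔓 (c 2)) (w k)) -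
          algebraMap (blowupAlgebra 𝔓 (c 2)) L (algebraMap R (blowupAlgebra 𝔓 (c 2)) (c 2)) ^ 2 * (algebraMap (blowupAlgebra 𝔓 (c 2)) L (blowupAlgebra.gen 𝔓 (c 2) (c 0) (hc 0)) * algebraMap (blowupAlgebra 𝔓 (c 2)) L (blowupAlgebra.gen 𝔓 (c 2) (c 1) (hc 1))) * ∏ k ∈ T, algebraMap (blowupAlgebra 𝔓 (c 2)) L (algebraMap R (blowupAlgebra 𝔓 (c 2)) (w k)) =
          -(algebraMap (blowupAlgebra 𝔓 (c 2)) L (algebraMap R (blowupAlgebra 𝔓 (c 2)) (c 2)) ^ 2 * ∏ k ∈ T, algebraMap (blowupAlgebra 𝔓 (c 2)) L (algebraMap R (blowupAlgebra 𝔓 (c 2)) (w k))) * algebraMap (blowupAlgebra 𝔓 (c 2)) L (blowupAlgebra.gen 𝔓 (c 2) (c 0) (hc 0) * blowupAlgebra.gen 𝔓 (c 2) (c 1) (hc 1) - blowupAlgebra.gen 𝔓 (c 2) (c 2) (hc 2) * blowupAlgebra.gen 𝔓 (c 2) (c 3) (hc 3) * algebraMap R (blowupAlgebra 𝔓 (c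 2)) (∏ k ∈ S, w k)) by
        rw [hfeq, hH1, mul_one, map_sub, map_mul]; ring]
      exact Ideal.mul_mem_left _ _ (Ideal.mem_span_singleton_self _)
  · -- `c₃/c₂ ∉ 𝔔` and `S = {k₀}`: replace `w_{k₀}`
    obtain ⟨v, hv⟩ := (hunit 3 h3).exists_left_inv
    have hSne : S.Nonempty := by
      rw [Finset.nonempty_iff_ne_empty]
      intro hS
      apply h3
      have hH1 : algebraMap R (blowupAlgebra 𝔓 (c 2)) (∏ k ∈ S, w k) = 1 := by rw [hS, Finset.prod_empty, map_one]
      have := 𝔔.sub_mem (𝔔.mul_mem_right (blowupAlgebra.gen 𝔓 (c 2) (c 1) (hc 1)) h0) hf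
      rwa [hfeq, hH1, mul_one, sub_sub_cancel] at this
    obtain ⟨k₀, hk₀⟩ := hSne
    have hS : S = {k₀} := Finset.eq_singleton_iff_unique_mem.mpr
      ⟨hk₀, fun k hk => Finset.card_le_one.mp hν.2 k hk k₀ hk₀⟩
    have hHk : (∏ k ∈ S, w k) = w k₀ := by rw [hS, Finset.prod_singleton]
    have hk₀T : k₀ ∈ T := hST hk₀
    let jJ : Fin 2 → {k : Fin 4 // k ≠ 2} := ![⟨0, by decide⟩, ⟨1, by decide⟩]
    have hjJinj : Function.Injective jJ := by
      intro s s' h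
      fin_cases s <;> fin_cases s' <;> first | rfl | exact absurd h (by decide)
    have hjJ𝔔 : ∀ t, blowupAlgebra.gen 𝔓 (c 2) (c (jJ t).1) (hc _) ∈ 𝔔 := by
      intro t
      fin_cases t
      · exact h0
      · exact h1
    have hrs := chartsOverCentre_isRsopPart_chartFamily c 2 w hz hd 𝔓 h𝔓 hc 𝔔 h𝔔 L jJ hjJinj hjJ𝔔
    set z := chartFamily c 2 w L (algebraMap R (blowupAlgebra 𝔓 (c 2))) (fun k => blowupAlgebra.gen 𝔓 (c 2) (c k) (hc k)) jJ with hzdef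
    have hz0 : z 0 = algebraMap (blowupAlgebra 𝔓 (c 2)) L (algebraMap R (blowupAlgebra 𝔓 (c 2)) (c 2)) := chartsOverCentre_chartFamily_zero c 2 w (algebraMap R (blowupAlgebra 𝔓 (c 2))) _ jJ
    have hze0 : z (Fin.castAdd l 0).succ = algebraMap (blowupAlgebra 𝔓 (c 2)) L (blowupAlgebra.gen 𝔓 (c 2) (c 0) (hc 0)) := chartsOverCentre_chartFamily_gen c 2 w (algebraMap R (blowupAlgebra 𝔓 (c 2))) _ jJ 0
    have hze1 : z (Fin.castAdd l 1).succ = algebraMap (blowupAlgebra 𝔓 (c 2)) L (blowupAlgebra.gen 𝔓 (c 2) (c 1) (hc 1)) := chartsOverCentre_chartFamily_gen c 2 w (algebraMap R (blowupAlgebra 𝔓 (c 2))) _ jJ 1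
    have hzw : z (Fin.natAdd 2 k₀).succ = algebraMap (blowupAlgebra 𝔓 (c 2)) L (algebraMap R (blowupAlgebra 𝔓 (c 2)) (w k₀)) := chartsOverCentre_chartFamily_w c 2 w (algebraMap R (blowupAlgebra 𝔓 (c 2))) _ jJ k₀
    have hne0 : (Fin.castAdd l (0 : Fin 2)).succ ≠ (Fin.natAdd 2 k₀).succ := fun h => by
      have := congrArg Fin.val (Fin.succ_injective _ h)
      simp at this
      omega
    have hne1 : (Fin.castAdd l (1 : Fin 2)).succ ≠ (Fin.natAdd 2 k₀).succ := fun h => by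
      have := congrArg Fin.val (Fin.succ_injective _ h)
      simp at this
      omega
    have hy : algebraMap (blowupAlgebra 𝔓 (c 2)) L (blowupAlgebra.gen 𝔓 (c 2) (c 0) (hc 0) * blowupAlgebra.gen 𝔓 (c 2) (c 1) (hc 1) - blowupAlgebra.gen 𝔓 (c 2) (c 2) (hc 2) * blowupAlgebra.gen 𝔓 (c 2) (c 3) (hc 3) * algebraMap R (blowupAlgebra 𝔓 (c 2)) (∏ k ∈ S, w k)) ∈ Ideal.span (Set.range z) := by
      rw [hfeq, hHk, map_sub, map_mul, map_mul, ← hze0, ← hzw]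
      exact Ideal.sub_mem _ (Ideal.mul_mem_right _ _ (Ideal.subset_span ⟨_, rfl⟩))
        (Ideal.mul_mem_left _ _ (Ideal.subset_span ⟨_, rfl⟩))
    have hzmem : z (Fin.natAdd 2 k₀).succ ∈
        Ideal.span (Set.range (Function.update z (Fin.natAdd 2 k₀).succ (algebraMap (blowupAlgebra 𝔓 (c 2)) L (blowupAlgebra.gen 𝔓 (c 2) (c 0) (hc 0) * blowupAlgebra.gen 𝔓 (c 2) (c 1) (hc 1) - blowupAlgebra.gen 𝔓 (c 2) (c 2) (hc 2) * blowupAlgebra.gen 𝔓 (c 2) (c 3) (hc 3) * algebraMap R (blowupAlgebra 𝔓 (c 2)) (∏ k ∈ S, w k))))) := by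
      have key : z (Fin.natAdd 2 k₀).succ = v *
          (Function.update z (Fin.natAdd 2 k₀).succ (algebraMap (blowupAlgebra 𝔓 (c 2)) L (blowupAlgebra.gen 𝔓 (c 2) (c 0) (hc 0) * blowupAlgebra.gen 𝔓 (c 2) (c 1) (hc 1) - blowupAlgebra.gen 𝔓 (c 2) (c 2) (hc 2) * blowupAlgebra.gen 𝔓 (c 2) (c 3) (hc 3) * algebraMap R (blowupAlgebra 𝔓 (c 2)) (∏ k ∈ S, w k))) (Fin.castAdd l 0).succ *
            Function.update z (Fin.natAdd 2 k₀).succ (algebraMap (blowupAlgebra 𝔓 (c 2)) L (blowupAlgebra.gen 𝔓 (c 2) (c 0) (hc 0) * blowupAlgebra.gen 𝔓 (c 2) (c 1) (hc 1) - blowupAlgebra.gen 𝔓 (c 2) (c 2) (hc 2) * blowupAlgebra.gen 𝔓 (c 2) (c 3) (hc 3) * algebraMap R (blowupAlgebra 𝔓 (c 2)) (∏ k ∈ S, w k))) (Fin.castAdd l 1).succ -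
          Function.update z (Fin.natAdd 2 k₀).succ (algebraMap (blowupAlgebra 𝔓 (c 2)) L (blowupAlgebra.gen 𝔓 (c 2) (c 0) (hc 0) * blowupAlgebra.gen 𝔓 (c 2) (c 1) (hc 1) - blowupAlgebra.gen 𝔓 (c 2) (c 2) (hc 2) * blowupAlgebra.gen 𝔓 (c 2) (c 3) (hc 3) * algebraMap R (blowupAlgebra 𝔓 (c 2)) (∏ k ∈ S, w k))) (Fin.natAdd 2 k₀).succ) := by
        rw [Function.update_self, Function.update_of_ne hne0, Function.update_of_ne hne1, hze0, hze1, hzw,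
          hfeq, hHk, map_sub, map_mul, map_mul]
        calc algebraMap (blowupAlgebra 𝔓 (c 2)) L (algebraMap R (blowupAlgebra 𝔓 (c 2)) (w k₀)) = (v * algebraMap (blowupAlgebra 𝔓 (c 2)) L (blowupAlgebra.gen 𝔓 (c 2) (c 3) (hc 3))) * algebraMap (blowupAlgebra 𝔓 (c 2)) L (algebraMap R (blowupAlgebra 𝔓 (c 2)) (w k₀)) := by rw [hv, one_mul]
          _ = _ := by ring
      rw [key]
      exact Ideal.mul_mem_left _ _ (Ideal.sub_mem _ (Ideal.mul_mem_left _ _ (Ideal.subset_span ⟨_, rfl⟩))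
        (Ideal.subset_span ⟨_, rfl⟩))
    have hspan := chartsOverCentre_span_range_update_eq z _ _ hy hzmem
    refine ⟨2 + l + 1, Function.update z (Fin.natAdd 2 k₀).succ (algebraMap (blowupAlgebra 𝔓 (c 2)) L (blowupAlgebra.gen 𝔓 (c 2) (c 0) (hc 0) * blowupAlgebra.gen 𝔓 (c 2) (c 1) (hc 1) - blowupAlgebra.gen 𝔓 (c 2) (c 2) (hc 2) * blowupAlgebra.gen 𝔓 (c 2) (c 3) (hc 3) * algebraMap R (blowupAlgebra 𝔓 (c 2)) (∏ k ∈ S, w k))), (Fin.natAdd 2 k₀).succ, 0,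
      Fin.cons 2 (Fin.append ![1, 1] fun k => if k ∈ T.erase k₀ then 1 else 0), 1, Fin.succ_ne_zero _,
      chartsOverCentre_isRsopPart_of_span_eq hrs hspan, Function.update_self _ _ _, ?_, rfl, ?_,
      fun i hi => ?_, isUnit_one, ?_⟩
    · rw [Function.update_of_ne (Fin.succ_ne_zero _).symm, hz0]
    · rw [Fin.cons_succ, Fin.append_right]
      simp
    · obtain ⟨i, rfl⟩ := Fin.exists_succ_eq.mpr hi
      rw [Fin.cons_succ]
      refine Fin.addCases (fun t => ?_) (fun k => ?_) i
      · rw [Fin.append_left]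
        fin_cases t <;> simp
      · rw [Fin.append_right]
        split_ifs <;> omega
    · rw [chartsOverCentre_prod_update_pow _ _ _ _ (by rw [Fin.cons_succ, Fin.append_right]; simp), hzdef,
        chartsOverCentre_prod_chartFamily_pow, hbdry, Fin.prod_univ_two, ← Finset.mul_prod_erase _ _ hk₀T]
      simp only [jJ, Matrix.cons_val_zero, Matrix.cons_val_one, pow_one, one_mul]
      rw [show algebraMap (blowupAlgebra 𝔓 (c 2)) L (algebraMap R (blowupAlgebra 𝔓 (c 2)) (c 2)) ^ 2 * algebraMap (blowupAlgebra 𝔓 (c 2)) L (blowupAlgebra.gen 𝔓 (c 2) (c 3) (hc 3)) * (algebraMap (blowupAlgebra 𝔓 (c 2)) L (algebraMap R (blowupAlgebra 𝔓 (c 2)) (w k₀)) * ∏ k ∈ T.erase k₀, algebraMap (blowupAlgebra 𝔓 (c 2)) L (algebraMap R (blowupAlgebra 𝔓 (c 2)) (w k))) -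
          algebraMap (blowupAlgebra 𝔓 (c 2)) L (algebraMap R (blowupAlgebra 𝔓 (c 2)) (c 2)) ^ 2 * (algebraMap (blowupAlgebra 𝔓 (c 2)) L (blowupAlgebra.gen 𝔓 (c 2) (c 0) (hc 0)) * algebraMap (blowupAlgebra 𝔓 (c 2)) L (blowupAlgebra.gen 𝔓 (c 2) (c 1) (hc 1))) * ∏ k ∈ T.erase k₀, algebraMap (blowupAlgebra 𝔓 (c 2)) L (algebraMap R (blowupAlgebra 𝔓 (c 2)) (w k)) =
          -(algebraMap (blowupAlgebra 𝔓 (c 2)) L (algebraMap R (blowupAlgebra 𝔓 (c 2)) (c 2)) ^ 2 * ∏ k ∈ T.erase k₀, algebraMap (blowupAlgebra 𝔓 (c 2)) L (algebraMap R (blowupAlgebra 𝔓 (c 2)) (w k))) * algebraMap (blowupAlgebra 𝔓 (c 2)) L (blowupAlgebra.gen 𝔓 (c 2) (c 0) (hc 0) * blowupAlgebra.gen 𝔓 (c 2) (c 1) (hc 1) - blowupAlgebra.gen 𝔓 (c 2) (c 2) (hc 2) * blowupAlgebra.gen 𝔓 (c 2) (c 3) (hc 3) * algebraMap R (blowupAlgebra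 𝔓 (c 2)) (∏ k ∈ S, w k)) by
        rw [hfeq, hHk, map_sub, map_mul, map_mul]; ring]
      exact Ideal.mul_mem_left _ _ (Ideal.mem_span_singleton_self _)


end Summit.ResolutionOfSingularities.ResolutionOfSingularities.Theorems

end
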